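/-
COR-CM (cell pub-hodgecm2, stage 2 of the Hodge ladder) — count-neutral KERNEL COMBINATORICS «β − 1 faces for every Galois CM field of dicyclic type»
(seat prover-pub-hodgecm2-b23-g42-0, binder prover b23, gen 42; claim DICYCLIC-COLUMN, HOME/INBOX.md l.10328).
Theorems only; no geometry beyond the tree's `Face` / `faceOfG`, no `Universe` field touched, no named fact, nothing asserted; the lane
`Census/DicyclicTwist*` (this seat), the generic transfer `CorCM/FaceGenerationTransfer.lean` and the INT2-GEN socket (`CorCM/FacePeriodsGeneratingSet.lean`)
are used BY NAME; `Interfaces.lean` (C1), every E term, B01, `Transposition/*`, `PortJoin/*` are untouched.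
HONEST FRAMING (COORDINATOR RULING — HODGE FRAMING CORRECTION, 2026-08-21T11:55:35Z): `HC_CM` is NOT proved, here or anywhere in the tree;
this file produces no period and proves no face period for any field; its `HodgeConjectureFor` statements are CONDITIONAL on face periods.
T5: n/a-class — the only Prop hypothesis binders displayed are the dicyclic datum (its `Aut`-form equations), `|A|` odd, `3 ≤ |A|` and INT2-GEN's period
hypothesis on the produced face set (§3); no named-fact / conjecture-def binder; checker: self (prover-pub-hodgecm2-b23-g42-0), 2026-08-23.
-/
import Summits.HodgeConjecture.CorCM.Census.DicyclicTwistTransport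
import Summits.HodgeConjecture.CorCM.Census.DicyclicTwistBlockCount
import Summits.HodgeConjecture.CorCM.FaceGenerationTransfer
import Summits.HodgeConjecture.CorCM.FaceCensusOddSliceTransport
import HarnessLib

/-!
# Galois CM fields of dicyclic type: EXACTLY `β − 1` generating rank-four faces

Let `F` be a Galois CM field whose Galois translates `GalT F` carry a DICYCLIC DATUM over a finite abelian group `A` of ODD order `≥ 3`
(`Census/DicyclicTwistDictionary.lean`, `DicyclicTwist.Datum (GalT F) conjT A`): an embedded copy `ι : ℤ/2 × A ↪ GalT F` with `ι (1,0) = conjT`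
and a translate `x` outside it with `x·ι a = ι(−a)·x`, `x² = conjT`, the two cosets exhausting `GalT F` — i.e. `Gal(F/ℚ) ≅ Dic(ℤ/2 × A, c)`, the
generalised dicyclic group in which complex conjugation `c = x²` is a square (`[F:ℚ] = 4|A| ≥ 12`; for `A = ℤ/m`: the dicyclic group `Dic_m` of order
`4m`, e.g. the degree-`12` fields with group `Dic₃ = C₃ ⋊ C₄` and the degree-`20` fields with group `Dic₅` of lit-andre-3's atlas).  Complex conjugation
is not complemented, so none of `CorCM/FaceAbelian*`, `CorCM/FaceComplement*`, `CorCM/FaceCyclicGeneration`, `CorCM/FaceQuarticTwist*` applies.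
Write `β(F) = #Block conjT` (↔ the simple CM isogeny classes split by `F`).

* §1 **`isLeast_card_faces_hgen_of_dicyclic`** / **`exists_faces_hgen_of_dicyclic`**: for every base embedding `σ₀` the least size of a finite set `𝒮`
  of rank-four faces of `F` satisfying INT2-GEN's generation binder `hgen(𝒮, σ₀)` is **EXACTLY `β(F) − 1`**.  Existence is this seat's generation theorem for
  the dicyclic twist (`Census/DicyclicTwistCount.lean` `exists_generating_family`: one potential-reducing face per non-residual block and two closing
  squares, through the residual functionals `U s, U' s, C₀, C₁` and the key lemma of `Census/DicyclicTwistKeyLemma.lean`) transported to `CMF (GalT F) conjT`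
  (`Census/DicyclicTwistTransport.lean` `exists_gfaces_generate`); the floor is seat b09's block-parity floor (`Census/BlockParityRelations.lean`,
  `Census/BlockParityTransfer.lean`: the twisting translate `x` has `x^{[F:ℚ]/2} = conjT ≠ 1`, `DicyclicTwist.card_block_le_card_add_one`); both are carried
  to the field by `CorCM/FaceGenerationTransfer.lean` (`FaceTransfer.isLeast_card_faces_hgen_of_intrinsic`).
* §1 (cont.) the first rows: group `Dic₃` (degree `12`): EXACTLY `5` faces; `Dic₅` (degree `20`): `51`; `Dic₇` (degree `28`): `585`
  (`Census/DicyclicTwistBlockCount.lean`: `β = 6, 52, 586` by seat b09's Burnside count).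
* §2 the datum from the automorphism group (`exists_faces_hgen_of_dicyclic_aut`: `ι₀ : ℤ/2 × A → Aut(F)` multiplicative and injective with `ι₀ (1,0)`
  inducing complex conjugation at `σ₀`, `x₀ ∉ ι₀(ℤ/2 × A)` with `x₀·ι₀ a = ι₀(−a)·x₀`, `x₀² = ι₀ (1,0)`, and `[F:ℚ] = 4|A|`), and the degree
  (`finrank_eq_four_mul_card`).
* §3 **`hodgeConjectureFor_of_dicyclic_of_exists_facePeriod`** (INT2-GEN socket BY NAME): a face set with `|𝒮| + 1 = β(F)` EXISTS whose periods on the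
  universe of record give the Hodge conjecture for every abelian variety dominated by a product of CM abelian varieties with CM by subfields of `F` —
  CONDITIONAL on those periods; `HC_CM` is NOT proved.

References: [cite: Pohlmann1968, Thm. 1]; [cite: Milne1999LefschetzClasses, Thm. 3.2, Prop. 2.1]; [cite: Shimura1998, §6.2 Theorem 3 and §6.1
Corollary of Theorem 2 (pp. 41–43), §8.1 (p. 62)]; [cite: MumfordAV1970, §19 Thm. 1 and p. 169].
-/

noncomputable section

open CategoryTheory NumberField NumberField.ComplexEmbedding
open Literature.AlgebraicGeometry Literature.AlgebraicGeometry.Motives Literature.AlgebraicGeometry.HodgeTheory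
open Literature.AlgebraicGeometry.ComplexMultiplication Literature.AlgebraicGeometry.Milne1999
open Literature.NumberTheory.Automorphic
open Literature.NumberTheory.Automorphic.PicardCM
open Summit.HodgeConjecture.CorCM.Domination

namespace Summit.HodgeConjecture.CorCM.FaceDicyclicTwist

open Summit.HodgeConjecture.CorCM.Prior.AllgGroup.RfwfAllgGroup
open Summit.HodgeConjecture.CorCM.Census.BlockParity
open Summit.HodgeConjecture.CorCM.Census.Coinvariant
open Summit.HodgeConjecture.CorCM.Census
open Summit.HodgeConjecture.CorCM.FaceCensus.OddSlice (galTOfAut galTOfAut_mul galTOfAut_conjAut)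

/-! ## §1 Dicyclic datum on the Galois translates: exactly `β(F) − 1` generating faces -/

section Field

variable {F : Type} [Field F] [NumberField F]
variable {A : Type} [AddCommGroup A] [Fintype A] [DecidableEq A]

/-- **EVERY GALOIS CM FIELD OF DICYCLIC TYPE HAS `β − 1` GENERATING FACES, AND NONE FEWER**: for `F` Galois CM with a dicyclic datum `D` on `GalT F`
over a finite abelian group `A` of odd order `≥ 3` and any base embedding `σ₀`, the least size of a face set `𝒮` with `hgen(𝒮, σ₀)` is EXACTLY `β(F) − 1`
(`FaceTransfer.isLeast_card_faces_hgen_of_intrinsic` on `DicyclicTwist.exists_gfaces_generate` / `DicyclicTwist.card_block_le_card_add_one`). [folklore] -/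
theorem isLeast_card_faces_hgen_of_dicyclic [IsCMField F] [IsGalois ℚ F] (D : DicyclicTwist.Datum (GalT F) conjT A)
    (hA : Odd (Fintype.card A)) (h3 : 3 ≤ Fintype.card A) (σ₀ : F →+* ℂ) :
    IsLeast {m : ℕ | ∃ 𝒮 : Finset (Face F), 𝒮.card = m ∧
      ∀ f : Face F, lefChar f.corner (fun _ => ({σ₀} : Finset (F →+* ℂ))) ∈ AddSubgroup.closure
        {a : Asym F | ∃ g ∈ (𝒮 : Set (Face F)), ∃ σ : F →+* ℂ, a = lefChar g.corner (fun _ => ({σ} : Finset (F →+* ℂ)))}}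
      (Fintype.card (Block (conjT : GalT F)) - 1) := by
  refine FaceTransfer.isLeast_card_faces_hgen_of_intrinsic _ ?_ (fun S₀ _ hS => ?_) σ₀
  · obtain ⟨S, hS, hcard, hgen⟩ := DicyclicTwist.exists_gfaces_generate D conjT_mul_self hA h3
    exact ⟨S, hS, by omega, hgen⟩
  · have h := DicyclicTwist.card_block_le_card_add_one D conjT_mul_self hA S₀
      (fun y hy => hS (gfaceSet_subset_hodgeSpan conjT conjT_mul_self hy))
    omega

omit [DecidableEq A] in
/-- **The field-level floor**: every face set `𝒮` with `hgen(𝒮, σ₀)` has `β(F) ≤ |𝒮| + 1`. [folklore] -/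
theorem card_block_le_card_add_one_of_hgen [IsCMField F] [IsGalois ℚ F] (D : DicyclicTwist.Datum (GalT F) conjT A)
    (hA : Odd (Fintype.card A)) (𝒮 : Finset (Face F)) (σ₀ : F →+* ℂ)
    (hgen : ∀ f : Face F, lefChar f.corner (fun _ => ({σ₀} : Finset (F →+* ℂ))) ∈ AddSubgroup.closure
      {a : Asym F | ∃ g ∈ (𝒮 : Set (Face F)), ∃ σ : F →+* ℂ, a = lefChar g.corner (fun _ => ({σ} : Finset (F →+* ℂ)))}) :
    Fintype.card (Block (conjT : GalT F)) ≤ 𝒮.card + 1 := by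
  have h := FaceTransfer.le_card_of_hgen_of_floor (Fintype.card (Block (conjT : GalT F)) - 1) (fun S₀ _ hS => by
    have h := DicyclicTwist.card_block_le_card_add_one D conjT_mul_self hA S₀
      (fun y hy => hS (gfaceSet_subset_hodgeSpan conjT conjT_mul_self hy))
    omega) 𝒮 σ₀ hgen
  omega

/-- **Existence with the exact count**: a face set `𝒮` with `|𝒮| + 1 = β(F)` and `hgen(𝒮, σ₀)`. [folklore] -/
theorem exists_faces_hgen_of_dicyclic [IsCMField F] [IsGalois ℚ F] (D : DicyclicTwist.Datum (GalT F) conjT A)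
    (hA : Odd (Fintype.card A)) (h3 : 3 ≤ Fintype.card A) (σ₀ : F →+* ℂ) :
    ∃ 𝒮 : Finset (Face F), 𝒮.card + 1 = Fintype.card (Block (conjT : GalT F)) ∧
      ∀ f : Face F, lefChar f.corner (fun _ => ({σ₀} : Finset (F →+* ℂ))) ∈ AddSubgroup.closure
        {a : Asym F | ∃ g ∈ (𝒮 : Set (Face F)), ∃ σ : F →+* ℂ, a = lefChar g.corner (fun _ => ({σ} : Finset (F →+* ℂ)))} := by
  obtain ⟨⟨𝒮, hcard, hgen⟩, -⟩ := isLeast_card_faces_hgen_of_dicyclic D hA h3 σ₀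
  have hfloor := card_block_le_card_add_one_of_hgen D hA 𝒮 σ₀ hgen
  obtain ⟨S, -, hS1, -⟩ := DicyclicTwist.exists_gfaces_generate D conjT_mul_self hA h3
  exact ⟨𝒮, by omega, hgen⟩

/-- **Group `Dic₃` (degree `12`): EXACTLY `5` generating faces** (`β = 6`; lit-andre-3's certified row `μ(Dic₃) = 5`, now for every such field).
[folklore] -/
theorem isLeast_card_faces_hgen_five [IsCMField F] [IsGalois ℚ F] (D : DicyclicTwist.Datum (GalT F) conjT A)
    (h3 : Fintype.card A = 3) (σ₀ : F →+* ℂ) :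
    IsLeast {m : ℕ | ∃ 𝒮 : Finset (Face F), 𝒮.card = m ∧
      ∀ f : Face F, lefChar f.corner (fun _ => ({σ₀} : Finset (F →+* ℂ))) ∈ AddSubgroup.closure
        {a : Asym F | ∃ g ∈ (𝒮 : Set (Face F)), ∃ σ : F →+* ℂ, a = lefChar g.corner (fun _ => ({σ} : Finset (F →+* ℂ)))}} 5 := by
  have h := isLeast_card_faces_hgen_of_dicyclic D (by rw [h3]; exact ⟨1, rfl⟩) (by omega) σ₀
  rwa [DicyclicTwist.card_block_eq_six D conjT_mul_self h3] at h

/-- **Group `Dic₅` (degree `20`): EXACTLY `51` generating faces** (`β = 52`; lit-andre-3's certified row `μ(Dic₅) = 51`). [folklore] -/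
theorem isLeast_card_faces_hgen_fiftyOne [IsCMField F] [IsGalois ℚ F] (D : DicyclicTwist.Datum (GalT F) conjT A)
    (h5 : Fintype.card A = 5) (σ₀ : F →+* ℂ) :
    IsLeast {m : ℕ | ∃ 𝒮 : Finset (Face F), 𝒮.card = m ∧
      ∀ f : Face F, lefChar f.corner (fun _ => ({σ₀} : Finset (F →+* ℂ))) ∈ AddSubgroup.closure
        {a : Asym F | ∃ g ∈ (𝒮 : Set (Face F)), ∃ σ : F →+* ℂ, a = lefChar g.corner (fun _ => ({σ} : Finset (F →+* ℂ)))}} 51 := by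
  have h := isLeast_card_faces_hgen_of_dicyclic D (by rw [h5]; exact ⟨2, rfl⟩) (by omega) σ₀
  rwa [DicyclicTwist.card_block_eq_fiftyTwo D conjT_mul_self h5] at h

/-- **Group `Dic₇` (degree `28`): EXACTLY `585` generating faces** (`β = 586`; a row beyond the certified atlas). [folklore] -/
theorem isLeast_card_faces_hgen_fiveHundredEightyFive [IsCMField F] [IsGalois ℚ F] (D : DicyclicTwist.Datum (GalT F) conjT A)
    (h7 : Fintype.card A = 7) (σ₀ : F →+* ℂ) :
    IsLeast {m : ℕ | ∃ 𝒮 : Finset (Face F), 𝒮.card = m ∧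
      ∀ f : Face F, lefChar f.corner (fun _ => ({σ₀} : Finset (F →+* ℂ))) ∈ AddSubgroup.closure
        {a : Asym F | ∃ g ∈ (𝒮 : Set (Face F)), ∃ σ : F →+* ℂ, a = lefChar g.corner (fun _ => ({σ} : Finset (F →+* ℂ)))}} 585 := by
  have h := isLeast_card_faces_hgen_of_dicyclic D (by rw [h7]; exact ⟨3, rfl⟩) (by omega) σ₀
  rwa [DicyclicTwist.card_block_eq_fiveHundredEightySix D conjT_mul_self h7] at h

/-! ## §2 The datum from the automorphism group; the degree -/

omit [DecidableEq A] in
/-- **The degree of a dicyclic-type field is `4|A|`.** [folklore] -/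
theorem finrank_eq_four_mul_card [IsGalois ℚ F] (D : DicyclicTwist.Datum (GalT F) conjT A) : Module.finrank ℚ F = 4 * Fintype.card A := by
  rw [← FaceCensus.card_galT, DicyclicTwist.card_eq_four_mul D]

omit [DecidableEq A] in
/-- A dicyclic-type field over `A` with `|A| ≥ 3` has degree at least `12`. [folklore] -/
theorem twelve_le_finrank [IsGalois ℚ F] (D : DicyclicTwist.Datum (GalT F) conjT A) (h3 : 3 ≤ Fintype.card A) : 12 ≤ Module.finrank ℚ F := by
  rw [finrank_eq_four_mul_card D]
  omega

omit [DecidableEq A] in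
/-- **The dicyclic datum from an `Aut`-datum.**  An injective multiplicative-to-additive `ι₀ : ℤ/2 × A → Aut(F)` whose `ι₀ (1,0)` induces complex
conjugation at `σ₀`, and `x₀ ∉ ι₀(ℤ/2 × A)` with `x₀·ι₀ a = ι₀(−a)·x₀`, `x₀² = ι₀ (1,0)`, in a field of degree `4|A|`, give a dicyclic datum on `GalT F`
through `galTOfAut σ₀` (exhaustion by counting, `DicyclicTwist.exhaust_of_card`). [folklore] -/
theorem exists_datum_of_aut [IsGalois ℚ F] (σ₀ : F →+* ℂ) (ι₀ : ZMod 2 × A → (F ≃ₐ[ℚ] F)) (x₀ : F ≃ₐ[ℚ] F)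
    (hι : ∀ a b, ι₀ (a + b) = ι₀ a * ι₀ b) (hcσ : σ₀.comp ((ι₀ (1, 0) : F ≃ₐ[ℚ] F) : F →+* F) = conjugate σ₀)
    (hx : ∀ a, x₀ * ι₀ a = ι₀ (-a) * x₀) (hxx : x₀ * x₀ = ι₀ (1, 0)) (hinj : Function.Injective ι₀) (hne : ∀ a, x₀ ≠ ι₀ a)
    (hcard : Module.finrank ℚ F = 4 * Fintype.card A) : Nonempty (DicyclicTwist.Datum (GalT F) conjT A) := by
  have hinj' : Function.Injective fun a => galTOfAut σ₀ (ι₀ a) := fun a b h => hinj ((galTOfAut σ₀).injective h)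
  have hne' : ∀ a, galTOfAut σ₀ x₀ ≠ galTOfAut σ₀ (ι₀ a) := fun a h => hne a ((galTOfAut σ₀).injective h)
  have hmul : ∀ a b, galTOfAut σ₀ (ι₀ (a + b)) = galTOfAut σ₀ (ι₀ a) * galTOfAut σ₀ (ι₀ b) := fun a b => by rw [hι, galTOfAut_mul]
  exact ⟨{ ι := fun a => galTOfAut σ₀ (ι₀ a)
           x := galTOfAut σ₀ x₀
           map_add := hmul
           map_c := galTOfAut_conjAut σ₀ hcσ
           x_mul := fun a => by
             show galTOfAut σ₀ x₀ * galTOfAut σ₀ (ι₀ a) = galTOfAut σ₀ (ι₀ (-a)) * galTOfAut σ₀ x₀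
             rw [← galTOfAut_mul, ← galTOfAut_mul, hx]
           x_mul_x := by rw [← galTOfAut_mul, hxx, galTOfAut_conjAut σ₀ hcσ]
           inj := hinj'
           x_ne := hne'
           exhaust := DicyclicTwist.exhaust_of_card _ _ hmul hinj' hne' (by rw [FaceCensus.card_galT, hcard]) }⟩

/-- **`Aut`-datum form of the count**: a face set with `|𝒮| + 1 = β(F)` and `hgen(𝒮, σ₀)`. [folklore] -/
theorem exists_faces_hgen_of_dicyclic_aut [IsCMField F] [IsGalois ℚ F] (σ₀ : F →+* ℂ) (ι₀ : ZMod 2 × A → (F ≃ₐ[ℚ] F)) (x₀ : F ≃ₐ[ℚ] F)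
    (hι : ∀ a b, ι₀ (a + b) = ι₀ a * ι₀ b) (hcσ : σ₀.comp ((ι₀ (1, 0) : F ≃ₐ[ℚ] F) : F →+* F) = conjugate σ₀)
    (hx : ∀ a, x₀ * ι₀ a = ι₀ (-a) * x₀) (hxx : x₀ * x₀ = ι₀ (1, 0)) (hinj : Function.Injective ι₀) (hne : ∀ a, x₀ ≠ ι₀ a)
    (hcard : Module.finrank ℚ F = 4 * Fintype.card A) (hA : Odd (Fintype.card A)) (h3 : 3 ≤ Fintype.card A) :
    ∃ 𝒮 : Finset (Face F), 𝒮.card + 1 = Fintype.card (Block (conjT : GalT F)) ∧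
      ∀ f : Face F, lefChar f.corner (fun _ => ({σ₀} : Finset (F →+* ℂ))) ∈ AddSubgroup.closure
        {a : Asym F | ∃ g ∈ (𝒮 : Set (Face F)), ∃ σ : F →+* ℂ, a = lefChar g.corner (fun _ => ({σ} : Finset (F →+* ℂ)))} := by
  obtain ⟨D⟩ := exists_datum_of_aut σ₀ ι₀ x₀ hι hcσ hx hxx hinj hne hcard
  exact exists_faces_hgen_of_dicyclic D hA h3 σ₀

end Field

/-! ## §3 The Hodge-conjecture reading through the INT2-GEN socket (conditional on the face periods) -/

variable {A : Type} [AddCommGroup A] [Fintype A] [DecidableEq A]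

/-- **HC for the slice of a Galois CM field of dicyclic type from `β − 1` face periods** (INT2-GEN socket BY NAME; CONDITIONAL on the
periods — `HC_CM` is NOT proved): for `K` Galois CM with a dicyclic datum on `GalT K` over `A` (`|A|` odd `≥ 3`) there is a face set `𝒮` with
`|𝒮| + 1 = β(K)` (none fewer can satisfy the generation binder) such that, if every face of `𝒮` has a non-vanishing period on the universe of record, the Hodge conjecture holds for every abelian
variety dominated by a product of CM abelian varieties with CM by subfields of `K`.
[cite: Shimura1998, §6.2 Theorem 3 and §6.1 Corollary of Theorem 2 (pp. 41–43)] [cite: Pohlmann1968, Thm. 1]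
[cite: Milne1999LefschetzClasses, Thm. 3.2 and Cor. 4.5] [cite: MumfordAV1970, §19 Thm. 1 and p. 169] -/
theorem hodgeConjectureFor_of_dicyclic_of_exists_facePeriod (K : CMField) [hGal : IsGalois ℚ K]
    (D : DicyclicTwist.Datum (GalT K) conjT A) (hA : Odd (Fintype.card A)) (h3 : 3 ≤ Fintype.card A) (σ₀ : (K : Type) →+* ℂ) :
    ∃ 𝒮 : Finset (Face K), 𝒮.card + 1 = Fintype.card (Block (conjT : GalT K)) ∧
      ((∀ f ∈ 𝒮, ∃ ι₁ : K →+* ℂ, f.Admissible ι₁ ∧ ∃ (V : HermSpace3 K ι₁) (σ : K →+* ℂ),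
        (Model.picardCMUniverse exists_isReal_hodgeModel_holds hodgePQ_independent_of_hodgeModel_holds
          BallQuotient.ballQuotientUniformised_holds cmAbelianVarietyRealised_holds).PeriodNV ι₁ V K f.psi σ) →
      ∀ {P B : AbelianVariety ℂ}, AbelianVariety.IsProductOf (fun B : AbelianVariety ℂ =>
        ∃ (E : Type) (_ : Field E) (_ : NumberField E) (_ : IsCMField E) (_ : E →+* (K : Type)) (Φ : CMType E)
          (ι : 𝓞 E →+* End B) (ϑ : E →+* Module.End ℂ (complexBetti B.X 1)),
          IsCMTypeRealisation Φ B ι ϑ) P →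
      AVDominatedBy B P → HodgeConjectureFor B.dim B.X) := by
  obtain ⟨𝒮, hcard, hgen⟩ := exists_faces_hgen_of_dicyclic (F := K) D hA h3 σ₀
  refine ⟨𝒮, hcard, fun h P B hP hB => ?_⟩
  have h6 : 6 ≤ Module.finrank ℚ K := le_trans (by norm_num) (twelve_le_finrank (F := K) D h3)
  exact hodgeConjectureFor_of_avDominatedBy_isProductOf_of_exists_facePeriod_on K h6 (𝒮 : Set (Face K)) σ₀ hgen
    (fun f hf => h f (Finset.mem_coe.mp hf)) hP hB

end Summit.HodgeConjecture.CorCM.FaceDicyclicTwist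

end
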